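import Summits.NavierStokesRegularity.NavierStokesRegularity.Theorems.PalasekTowerBreakdownEpisodeBaseGerm
import Summits.NavierStokesRegularity.FluidComputer.PalasekTowerGermHostStrictTiny

/-!
# `EpisodeBase` BY NAME for the KERNEL-NAMED germ design `S⋆ = strictTinySchedule c₄`

Cell `ns-blowup`, seat `ns-blowup-ecbridge-3` (g3); GROUP C «BRIDGE SUPPORT» of the route
`PalasekTowerBreakdown`, crux `EpisodeBase` (item stmt-NavierStokesRegularity-19179, R2 of record:
`EpisodeBase ↔ ∃ S*, HostPreparationD (HostClass.exact S*) ∧ FirstEpisodeD (HostClass.exact S*)`,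
`palasekTowerBreakdown_episodeBase_iff_exists_exact`). Sequel of
`PalasekTowerBreakdownEpisodeBaseGerm.lean` (the same statements for EVERY filler of the slot
`Germ.LevelZeroData`), specialised to the FIRST KERNEL FILLER `Germ.levelZeroData_named`
(`FluidComputer/PalasekTowerGermHostStrictTiny.lean`): the tiny flat carrier `Y₀ • B_a` of ecbridge-4
plus the explicit far horizontal pusher `∇ψ × Y₀e₃`. LABEL: E–C typing (KERNEL, proofs only, by name).
WHAT THIS IS NOT: not Navier–Stokes evidence — the first child of the R2 split (host preparation) now
holds for a CLOSED KERNEL TERM `S⋆`; the second child (the episode of `S⋆`) is an OPEN hypothesis here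
and, for this tiny design, presumably false (the flat blob dissipates at rate `∼ 1/a²`); nothing is
asserted about any flow after `τ₀`, about `RungG 1` or blow-up. HELPER for 19179 (`--supports`), closes
nothing.

* `palasekTowerBreakdown_hostPreparationD_strictTiny`: `HostPreparationD (HostClass.exact S⋆)` — the
  first conjunct of the R2 witness, for the kernel-named `S⋆`, with NO hypothesis;
* `palasekTowerBreakdown_exists_named_rising_host`: some schedule is prepared in its singleton class AND
  in `exact ⊓ rising κ` for some `κ > 0` (the Host series of record is rising in no `κ > 0`);
* `palasekTowerBreakdown_episodeBase_of_strictTiny_firstEpisodeD`: `EpisodeBase ⇐ FirstEpisodeD (exact S⋆)`;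
* `palasekTowerBreakdown_episodeBase_of_strictTiny_levelWitness`: `EpisodeBase ⇐ S⋆.LevelWitness 1 0` —
  ONE classical finite-energy flow of `S⋆`'s forced system from rest reaching `τ₁` below `(5/3)Y₁` on
  the window with the three level-`1` floors at `τ₁`.

References: S. Palasek, arXiv:2605.13827 §3.3, §4 (Step 2) [cite: Palasek2026ElementaryModel, §4];
H. Sohr, *The Navier–Stokes Equations* (2001), Ch. V Thm. 1.5.1 [cite: Sohr2001, Ch. V Thm. 1.5.1].
-/

noncomputable section

-- `Summit.<Summit>.<Problem>` is the tree's mandated summit-side namespace (CONVENTIONS §2); for this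
-- single-conjunct summit the two coincide, so the duplicate is deliberate.
set_option linter.dupNamespace false

namespace Summit.NavierStokesRegularity.NavierStokesRegularity.Theorems

open Set Function
open Summit.NavierStokesRegularity.FluidComputer.PalasekTowerClayBridge
open Summit.NavierStokesRegularity.FluidComputer.PalasekTowerClayBridge.Germ
open Literature.Analysis.FluidPDE

/-- **HOST PREPARATION FOR THE KERNEL-NAMED `S⋆`** (first conjunct of the R2 witness of `EpisodeBase`,
no hypothesis): the germ schedule of `strictTinyProfile strictTinyScale` is pinned, rigid, quiet and
carries a globally anchored registered level-`0` stage reading the profile at `τ₀ = 1`. [cite: Palasek2026ElementaryModel, §3.3] -/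
theorem palasekTowerBreakdown_hostPreparationD_strictTiny {c₄ : ℝ} (hc₄ : 0 < c₄) (hc₄' : c₄ ≤ 1) :
    HostPreparationD (HostClass.exact (strictTinySchedule c₄ hc₄ hc₄')) :=
  hostPreparationD_strictTinySchedule hc₄ hc₄'

/-- **A named host prepared with a POSITIVE RISING RATE**: some schedule is prepared in its singleton
class and in `exact ⊓ rising κ` for some `κ > 0`. [cite: Palasek2026ElementaryModel, §3.3] -/
theorem palasekTowerBreakdown_exists_named_rising_host :
    ∃ S : Schedule TowerRates.wide, HostPreparationD (HostClass.exact S) ∧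
      ∃ κ : ℝ, 0 < κ ∧ HostPreparationD ((HostClass.exact S).inter (HostClass.rising κ)) :=
  ⟨strictTinySchedule 1 one_pos le_rfl, hostPreparationD_strictTinySchedule one_pos le_rfl,
    exists_hostPreparationD_strictTinySchedule_rising one_pos le_rfl⟩

/-- **`EpisodeBase` from the EPISODE of the kernel-named `S⋆`**. [cite: Palasek2026ElementaryModel, §4] -/
theorem palasekTowerBreakdown_episodeBase_of_strictTiny_firstEpisodeD {c₄ : ℝ} (hc₄ : 0 < c₄)
    (hc₄' : c₄ ≤ 1) (hF : FirstEpisodeD (HostClass.exact (strictTinySchedule c₄ hc₄ hc₄'))) :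
    Summit.NavierStokesRegularity.NavierStokesRegularity.Theses.PalasekTowerBreakdown.EpisodeBase :=
  palasekTowerBreakdown_episodeBase_of_germ_firstEpisodeD levelZeroData_named hc₄ hc₄' hF

/-- **`EpisodeBase` from ONE LEVEL WITNESS of the kernel-named `S⋆`** (no re-push): a classical
finite-energy solution of `S⋆`'s forced system on `[0, τ₁]` from the zero datum, below `(5/3)Y₁` on
`[τ₀, τ₁]`, with the speed floor `Y₁`, the strain floor `A₁` and an `N₁`-core loop in the ball at `τ₁`.
[cite: Sohr2001, Ch. V Thm. 1.5.1] -/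
theorem palasekTowerBreakdown_episodeBase_of_strictTiny_levelWitness {c₄ : ℝ} (hc₄ : 0 < c₄)
    (hc₄' : c₄ ≤ 1) (hW : (strictTinySchedule c₄ hc₄ hc₄').LevelWitness 1 0) :
    Summit.NavierStokesRegularity.NavierStokesRegularity.Theses.PalasekTowerBreakdown.EpisodeBase :=
  palasekTowerBreakdown_episodeBase_of_germ_levelWitness levelZeroData_named hc₄ hc₄' hW

end Summit.NavierStokesRegularity.NavierStokesRegularity.Theorems

end
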